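import Summits.QuantumFields.BalabanUV.Beta.GAN24.EffectiveFormInsertionVolumeLimit

/-!
# `BalabanUV.Beta.GAN24.ConstantBackgroundVolumeLimit` — binder row G-an2-4 ∕ (CONV-C), route R7 «TWO CURRENCIES», PART 148: THE u-DERIVATIVE SECTOR ON `ℤ^d` IS UNCONDITIONAL FOR CONSTANT
# BACKGROUNDS — the displayed input of PART 147 (EL₂ of the first-order coupling `P(V_t)` = the background's infinite-volume limit) DISCHARGED for the class of constant backgrounds
# `V_t k μ ≡ v_μ` (`‖v_μ‖ ≤ α`; the same on every volume and level): the forward differences `∇_ν` have entries at integer readings that are EVENTUALLY CONSTANT along `side t → ∞` (the readings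
# of two fixed integer points coincide on a large torus iff the points do), so `P(v) = Σ_μ v_μ∇_μ` has pair entry limits; a constant background is Lipschitz with `(α, 0)`; hence PART 147's
# `conv_effIns_of_background` holds with NOTHING displayed for this class — the first non-translation-covariant… (here still translation-invariant, but `U ≠ 1`-type) instance of the
# u-derivative sector's `ℤ^d` END, and the witness that PART 147's socket is inhabited (unit b2b-balaban-gan24-p3, gen 54; v1)

NOT IN PRINT; OUR PROOF ([folklore] bookkeeping BY NAME over PART 147 (`conv_effIns_of_background`), PART 136 (`isInfiniteVolumeLimit_kdelta`'s window argument), NE2's `FirstOrderBackgroundModel`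
(`LipschitzBackground`, `Pmodel`, `firstOrder`), `B5Prop11Plancherel.fdiff ∕ shiftM ∕ unitVec`, the β-cell's `VectorTails.castT_add ∕ castT_single`, `InfiniteVolume` window dictionary;
[Balaban1987RG1] (1.21)–(1.22) p. 264 LOCATE the shapes; nothing printed is a hypothesis).
HONEST FRAMING (cell contract, verbatim): «discharging `BetaPertH` makes Bałaban's UV stability UNCONDITIONAL — a real constructive-QFT result; it is NOT the
continuum limit and NOT the Clay problem.»  HONEST DEPENDENCY (verbatim): «continuum YM on T⁴ ⇐ BetaPertH ∧ nine spine estimates (0/9 proved); BetaPertH ⇐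
(D1) ∧ (D4) ∧ CAP+tail; G-an2-4 gates asym, D1 and NE2/3/4.»

WHAT THIS FILE PROVES (0 sorry, 0 `def`; a constant background is displayed as a HYPOTHESIS `∀ t k μ i, V t k μ i = v μ`, no new definition):
* §1 `eventually_castT_eq_iff` (`side t → ∞` ⟹ eventually `û_t = v̂_t ↔ u = v`), **`tendsto_fdiff_pair`** (the entries of `∇_ν` at pairs of integer readings converge — they are eventually the
  `ℤ^d` stencil `c([z′ = z + e_ν][g = f] − [z′ = z][g = f])`).
* §2 `lipschitzBackground_of_const` (a constant background of size `≤ α` is `LipschitzBackground … α 0`), **`tendsto_Pmodel_const_pair`** (EL₂ of `P(v)` at fine integer pairs).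
* §3 **`conv_effIns_constBackground`** — PART 147's END with NOTHING displayed for constant backgrounds (`d ≥ 3`, `L ≥ 2`, `a > 0`, `μ ≠ ν`, even cubic volumes).
WHAT IT DOES NOT DO: non-constant backgrounds (census V185: pullbacks of one `ℤ^d` connection need the seam clauses); `U ≠ 1` beyond first order; `d ≤ 2`; odd volumes.  SUPPLIER work;
NEVER «G-an2-4 closed»; NOT (CONV-C), NOT D1, NOT `BetaPertH`, NOT continuum, NOT Clay.  Records: `HOME/b2b-balaban-gan24-p3/gen54/README.md`.
-/

noncomputable section

open scoped BigOperators ComplexConjugate Matrix Matrix.Norms.L2Operator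
open Filter Topology

namespace Summit.QuantumFields.BalabanUV.Beta.GAN24.ConstantBackgroundVolumeLimit

open Literature.MathematicalPhysics.QuantumFieldTheory.Balaban1983to89
open Literature.MathematicalPhysics.QuantumFieldTheory.Balaban1983to89.B5Prop11Plancherel (Tor fine fdiff shiftM unitVec)
open Literature.MathematicalPhysics.QuantumFieldTheory.Balaban1983to89.B5G183RateUnitTower (lev)
open Literature.MathematicalPhysics.QuantumFieldTheory.Balaban1983to89.B12Sec2to5 (betaPrime510)
open Literature.MathematicalPhysics.QuantumFieldTheory.Balaban1983to89.Beta (Site windowMap siteOf InWindow IsInfiniteVolumeLimit eventually_inWindow windowMap_siteOf)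
open Literature.MathematicalPhysics.QuantumFieldTheory.Balaban1983to89.Beta.FreeLegDictionary (cubic)
open Literature.MathematicalPhysics.QuantumFieldTheory.Balaban1983to89.Beta.BlockKernelVolumeSockets (evenPeriod tendsto_evenPeriod)
open Literature.MathematicalPhysics.QuantumFieldTheory.Balaban1983to89.Beta.VectorTails (castT castT_add castT_neg castT_single)
open Literature.MathematicalPhysics.QuantumFieldTheory.Balaban1983to89.Beta.LimitRate (StepRate limKernelOf KernelInputs)
open Summit.QuantumFields.BalabanUV.T4Continuum
open Summit.QuantumFields.BalabanUV.T4Continuum.CovariantAveragingTower (avgTow)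
open Summit.QuantumFields.BalabanUV.T4Continuum.BalabanAveragedTowerUnit (idx QBlev calGlev unitCovB)
open Summit.QuantumFields.BalabanUV.T4Continuum.BalabanAveragedCoerciveTower (unitIdx)
open Summit.QuantumFields.BalabanUV.T4Continuum.FirstOrderBackgroundModel (LipschitzBackground Pmodel firstOrder)
open Summit.QuantumFields.BalabanUV.Beta.GAN24.EffectiveFormInsertionVolumeLimit (conv_effIns_of_background)

variable {d : ℕ} (L : ℕ) [NeZero L]

/-! ## §1 Readings of fixed integer points on large tori; the forward difference at integer pairs -/

section Readings

variable {side : ℕ → ℕ} [∀ t, NeZero (side t)]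

/-- along `side t → ∞`, the readings of two FIXED integer points coincide iff the points do (eventually in `t`). [folklore] -/
theorem eventually_castT_eq_iff (hside : Tendsto side atTop atTop) (u v : Fin d → ℤ) :
    ∀ᶠ t : ℕ in atTop, castT (cubic d (side t)) u = castT (cubic d (side t)) v ↔ u = v := by
  filter_upwards [eventually_inWindow hside (u - v), eventually_inWindow hside 0] with t hx h0
  have key : castT (cubic d (side t)) (u - v) = 0 ↔ u - v = 0 := by
    constructor
    · intro h
      have e1 : windowMap d (side t) (siteOf d (side t) (u - v)) = u - v := windowMap_siteOf d (side t) hx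
      have e2 : siteOf d (side t) (u - v) = siteOf d (side t) 0 := by
        funext i; have := congrFun h i; simpa [siteOf, castT] using this
      rw [e2, windowMap_siteOf d (side t) h0] at e1
      exact e1.symm
    · intro h; rw [h]; funext i; simp [castT]
  rw [← sub_eq_zero, ← sub_eq_zero (a := u)]
  have e : castT (cubic d (side t)) u - castT (cubic d (side t)) v = castT (cubic d (side t)) (u - v) := by
    rw [sub_eq_add_neg, sub_eq_add_neg, castT_add, castT_neg]
  rw [e]; exact key

/-- **`tendsto_fdiff_pair` — THE FORWARD DIFFERENCE AT INTEGER PAIRS IS EVENTUALLY THE `ℤ^d` STENCIL** [folklore]: along `side t → ∞`, for fixed `c`, `ν`, `f, g`, `z, z′`: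
`(∇_ν)((ẑ,f),(ẑ′,g)) → c·([z′ = z + e_ν ∧ g = f] − [z′ = z ∧ g = f])`. -/
theorem tendsto_fdiff_pair (hside : Tendsto side atTop atTop) (c : ℂ) (ν f g : Fin d) (z z' : Fin d → ℤ) :
    Tendsto (fun t => fdiff (cubic d (side t)) c ν (castT (cubic d (side t)) z, f) (castT (cubic d (side t)) z', g)) atTop
      (𝓝 (c * ((if z' = z + Pi.single ν 1 ∧ g = f then 1 else 0) - (if z' = z ∧ g = f then 1 else 0)))) := by
  refine Tendsto.congr' ?_ tendsto_const_nhds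
  filter_upwards [eventually_castT_eq_iff (d := d) hside z' (z + Pi.single ν 1), eventually_castT_eq_iff (d := d) hside z z'] with t h1 h2
  have e1 : castT (cubic d (side t)) (z + Pi.single ν 1) = castT (cubic d (side t)) z + unitVec (cubic d (side t)) ν := by
    rw [castT_add, castT_single]; rfl
  have h1' : castT (cubic d (side t)) z' = castT (cubic d (side t)) z + unitVec (cubic d (side t)) ν ↔ z' = z + Pi.single ν 1 := by rw [← e1]; exact h1
  have h3 : (z = z' ∧ f = g) ↔ (z' = z ∧ g = f) := ⟨fun h => ⟨h.1.symm, h.2.symm⟩, fun h => ⟨h.1.symm, h.2.symm⟩⟩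
  simp only [fdiff, Matrix.smul_apply, Matrix.sub_apply, B5Prop11Plancherel.shiftM, Matrix.one_apply, Prod.mk.injEq, smul_eq_mul, h1', h2, h3]

end Readings

/-! ## §2 Constant backgrounds: Lipschitz with `(α, 0)`; the first-order coupling's pair entry limits -/

omit [NeZero L] in
/-- a constant background of size `≤ α` is `LipschitzBackground … α 0` on every torus. [folklore] -/
theorem lipschitzBackground_of_const (M : Fin d → ℕ) [∀ μ, NeZero (M μ)] {v : Fin d → ℂ} {α : ℝ} (hα0 : 0 ≤ α) (hα : ∀ μ, ‖v μ‖ ≤ α)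
    (V : (k : ℕ) → Fin d → (idx L M k → ℂ)) (hV : ∀ k μ i, V k μ i = v μ) : LipschitzBackground L M V α 0 where
  nonneg := ⟨hα0, le_rfl⟩
  bound := fun k μ i => by rw [hV]; exact hα μ
  lipschitz := fun k μ ν i => by rw [hV, hV, sub_self, norm_zero, zero_div]
  consistent := fun k μ i => by rw [hV, hV, sub_self, norm_zero, zero_div]

/-- **EL₂ of the first-order coupling of a constant background** [folklore]: along the even cubic volumes, the entries of `P(v)^{(k)} = Σ_μ v_μ∇^{(k)}_μ` at pairs of fine integer readings converge. -/
theorem tendsto_Pmodel_const_pair (k : ℕ) {v : Fin d → ℂ} (V : (t : ℕ) → (k : ℕ) → Fin d → (idx L (cubic d (evenPeriod t)) k → ℂ)) (hV : ∀ t k μ i, V t k μ i = v μ)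
    (f g : Fin d) (z z' : Fin d → ℤ) :
    ∃ s : ℂ, Tendsto (fun t => Pmodel L (cubic d (evenPeriod t)) (V t) k (castT (cubic d (lev L k * evenPeriod t)) z, f) (castT (cubic d (lev L k * evenPeriod t)) z', g)) atTop (𝓝 s) := by
  have hside : Tendsto (fun t => lev L k * evenPeriod t) atTop atTop :=
    Filter.Tendsto.const_mul_atTop' (Nat.pos_of_ne_zero (NeZero.ne (lev L k))) tendsto_evenPeriod |>.congr fun t => by ring
  refine ⟨∑ μ, v μ * (((lev L k : ℕ) : ℂ) * ((if z' = z + Pi.single μ 1 ∧ g = f then 1 else 0) - (if z' = z ∧ g = f then 1 else 0))), ?_⟩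
  have e : ∀ t, Pmodel L (cubic d (evenPeriod t)) (V t) k (castT (cubic d (lev L k * evenPeriod t)) z, f) (castT (cubic d (lev L k * evenPeriod t)) z', g)
      = ∑ μ, v μ * fdiff (cubic d (lev L k * evenPeriod t)) ((lev L k : ℕ) : ℂ) μ (castT (cubic d (lev L k * evenPeriod t)) z, f) (castT (cubic d (lev L k * evenPeriod t)) z', g) := by
    intro t
    unfold Pmodel firstOrder
    rw [Matrix.sum_apply]
    refine Finset.sum_congr rfl fun μ _ => ?_
    rw [Matrix.diagonal_mul, hV]
  simp only [e]
  exact tendsto_finsetSum _ fun μ _ => (tendsto_fdiff_pair (d := d) hside ((lev L k : ℕ) : ℂ) μ f g z z').const_mul (v μ)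

/-! ## §3 The u-derivative sector for constant backgrounds, unconditionally -/

variable (a : ℝ) (ha : 0 < a)

/-- **`conv_effIns_constBackground` — THE u-DERIVATIVE SECTOR ON `ℤ^d`, UNCONDITIONALLY, FOR CONSTANT BACKGROUNDS** [our proof] (`d ≥ 3`, `L ≥ 2`, `a > 0`, `μ ≠ ν`, along the even
cubic volumes): for every constant background `v : Fin d → ℂ` (read on every volume and level as `V_t k μ ≡ v_μ`) the tower `c_k⁻¹·[L^{dk}Q_k(𝒢^{(k)}P(v)𝒢^{(k)})Q_kᴴ]·c_k⁻¹` (PART 128's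
`Σ̇_k` up to sign) has limit kernels `Π_k` (`IsInfiniteVolumeLimit`), `UniformDecay`, `StepRate (√(L⁻¹))`, `KernelInputs d Π`, `|secondMoment (Π k) μ ν − secondMoment Π_∞ μ ν| ≤ c₀(√(L⁻¹))^k` — PART 147
with its one displayed input supplied by §2.  NOTHING DISPLAYED. [cite: Balaban1987RG1, (1.21)–(1.22) p.264 (shapes)] -/
theorem conv_effIns_constBackground (hL : 2 ≤ L) (hd : 3 ≤ d) {μ ν : Fin d} (hne : μ ≠ ν) (v : Fin d → ℂ)
    (V : (t : ℕ) → (k : ℕ) → Fin d → (idx L (cubic d (evenPeriod t)) k → ℂ)) (hV : ∀ t k μ i, V t k μ i = v μ) :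
    ∃ κ B B' : ℝ, 0 < κ ∧ 0 ≤ B ∧ 0 ≤ B' ∧ ∃ Pinf : ℕ → B12Beta.Kernel d,
      (∀ k, IsInfiniteVolumeLimit evenPeriod
        (fun t μ' ν' (z : Site d (evenPeriod t)) => (((unitCovB L (cubic d (evenPeriod t)) a ha k)⁻¹
            * avgTow (QBlev L (cubic d (evenPeriod t))) ((L : ℝ) ^ d)
                (fun k' => calGlev L (cubic d (evenPeriod t)) a ha k' * Pmodel L (cubic d (evenPeriod t)) (V t) k' * calGlev L (cubic d (evenPeriod t)) a ha k') k
            * (unitCovB L (cubic d (evenPeriod t)) a ha k)⁻¹)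
          ((unitIdx L (cubic d (evenPeriod t))).symm (z, μ')) ((unitIdx L (cubic d (evenPeriod t))).symm (0, ν'))).re) (Pinf k)) ∧
      Beta.LimitRate.UniformDecay Pinf μ ν B (κ / d) ∧ StepRate Pinf μ ν B' (κ / d) (Real.sqrt ((L : ℝ)⁻¹)) ∧
      (∃ K : KernelInputs d Pinf, K.θ = Real.sqrt ((L : ℝ)⁻¹) ∧ K.c₀ = betaPrime510 d (B' / (1 - Real.sqrt ((L : ℝ)⁻¹))) (κ / d) ∧ K.Pinf = limKernelOf Pinf ∧ K.μ = μ ∧ K.ν = ν) ∧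
      (∀ k, |B12Beta.secondMoment (Pinf k) μ ν - B12Beta.secondMoment (limKernelOf Pinf) μ ν|
          ≤ betaPrime510 d (B' / (1 - Real.sqrt ((L : ℝ)⁻¹))) (κ / d) * Real.sqrt ((L : ℝ)⁻¹) ^ k) := by
  have hα : ∀ μ, ‖v μ‖ ≤ ∑ μ, ‖v μ‖ := fun μ => Finset.single_le_sum (fun μ _ => norm_nonneg (v μ)) (Finset.mem_univ μ)
  exact conv_effIns_of_background L a ha hL hd hne
    (fun t => lipschitzBackground_of_const L (cubic d (evenPeriod t)) (Finset.sum_nonneg fun μ _ => norm_nonneg (v μ)) hα (V t) (hV t))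
    (fun k f g z z' => tendsto_Pmodel_const_pair L k V hV f g z z')

end Summit.QuantumFields.BalabanUV.Beta.GAN24.ConstantBackgroundVolumeLimit

end
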